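import Summits.HubbardSuperconductivity.HubbardSuperconductivity.Theorems.AnisotropyChordTransferFibre3LemmaVTargets
import Summits.HubbardSuperconductivity.HubbardSuperconductivity.Theorems.AnisotropyChordTransferFibre3TwoMagnonQF

/-!
# Route `AnisotropyChord` / H0 rotor rung: HOLE₂(.75) FAILS AT `L = 8` — `¬ TwoHoleGap 8 (¾ε₁)` by an explicit witness

The GM₃ ∀L assembly `gm3_of_hole2` / `gm3_of_cruxes_twoHoleGap` (`8 ≤ L`) takes the one-body fact HOLE₂(.75) =
`TwoHoleGap L (3/4·eps1 L)` as a hypothesis.  The typed table (`…Fibre3LemmaVTargets`, docstring of `TwoHoleGap`: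
`gap₂/ε₁ = .737` at `L = 8`, worst pair = diagonal neighbours) says this hypothesis is FALSE at `L = 8`; this file makes that a
theorem, so that the `L = 8` instance of the HOLE₂ route is recorded as vacuous and `L = 8` is routed to the direct `SecondGapK1`
certification (theory memo 21 §313/§314, LEVEL2-SPEC §5: «4 ≤ L ≤ 8: certify SecondGapK1 directly»):
* `wit`: the second Neumann eigenvector of the rate-½ walk on `ℤ₈² ∖ {(0,0),(1,1)}` (×10⁴, rounded; antisymmetric under `x ↔ y`,
  hence exactly mean-zero), as an integer table; `sum_mI = 0`, `sum_aI = 100014132` (`Σ|f|²`), `sum_bI = 86349640` (ordered-bond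
  Dirichlet sum) by `decide`;
* ★★ `not_twoHoleGap_eight : ¬ TwoHoleGap 8 (3/4 * eps1 8)`: the Rayleigh quotient of the witness is
  `86349640/(4·100014132) = .21584 = .7369·ε₁ < ¾ε₁ = .21967` (`ε₁ = 1 − √2/2`).
Prover seat `hubbard-h0-rotor-p1` g24; helper for stmt-HubbardSuperconductivity-19089 (`--supports`).
-/

set_option linter.dupNamespace false
set_option autoImplicit false

noncomputable section

open scoped BigOperators
open Complex

namespace Summit.HubbardSuperconductivity.HubbardSuperconductivity.Theorems.AnisotropyChord.Transfer.Fibre3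

namespace HoleTwoL8

/-- the witness table, rows `x = 0..7`, columns `y = 0..7` (holes `(0,0)`, `(1,1)` carry `0`). [folklore] -/
def wit : Fin 8 → Fin 8 → ℤ :=
  ![![0, 2859, 2242, 1617, 771, -149, -877, -1214],
    ![-2859, 0, 1214, 877, 149, -771, -1617, -2242],
    ![-2242, -1214, 0, 149, -344, -1134, -1879, -2310],
    ![-1617, -877, -149, 0, -392, -1054, -1644, -1879],
    ![-771, -149, 344, 392, 0, -591, -1054, -1134],
    ![149, 771, 1134, 1054, 591, 0, -392, -344],
    ![877, 1617, 1879, 1644, 1054, 392, 0, 149],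
    ![1214, 2242, 2310, 1879, 1134, 344, -149, 0]]

/-- a `ZMod 8` coordinate read as a `Fin 8` index. [folklore] -/
def toF (a : ZMod 8) : Fin 8 := a

/-- the integer witness on the torus `ℤ₈²`. [folklore] -/
def wI (x : Tor 8) : ℤ := wit (toF x.1) (toF x.2)

/-- the second hole `(1,1)` (the first is the origin). [folklore] -/
def z2 : Tor 8 := (((1 : ZMod 8)), ((1 : ZMod 8)))

/-- mean-zero integrand off the holes. [folklore] -/
def mI (x : Tor 8) : ℤ := if (x = 0 ∨ x = z2) then 0 else wI x

/-- `|f|²` off the holes. [folklore] -/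
def aI (x : Tor 8) : ℤ := if (x = 0 ∨ x = z2) then 0 else wI x ^ 2

/-- the guarded ordered-bond term in direction `e`. [folklore] -/
def bI (x e : Tor 8) : ℤ := if (x = 0 ∨ x = z2 ∨ x + e = 0 ∨ x + e = z2) then 0 else (wI x - wI (x + e)) ^ 2

/-- the witness has zero mean off the holes (it is antisymmetric under `x ↔ y`). [folklore] -/
theorem sum_mI : ∑ x : Tor 8, mI x = 0 := by decide

/-- `Σ_{x ∉ ζ} |f x|² = 100014132`. [folklore] -/
theorem sum_aI : ∑ x : Tor 8, aI x = 100014132 := by decide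

set_option maxRecDepth 20000 in
/-- the guarded ordered-bond Dirichlet sum `= 86349640`. [folklore] -/
theorem sum_bI : ∑ x : Tor 8, (bI x (ex 8) + bI x (-ex 8) + bI x (ey 8) + bI x (-ey 8)) = 86349640 := by
  decide +kernel

/-- the complex-valued witness. [folklore] -/
def fW (x : Tor 8) : ℂ := ((wI x : ℤ) : ℂ)

/-- real/integer bridge for the mass term. [folklore] -/
theorem aR (x : Tor 8) : (if (x = 0 ∨ x = z2) then (0 : ℝ) else ‖fW x‖ ^ 2) = ((aI x : ℤ) : ℝ) := by
  unfold aI fW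
  split_ifs
  · simp
  · push_cast
    rw [Complex.norm_intCast, sq_abs]

/-- complex/integer bridge for the mean. [folklore] -/
theorem mR (x : Tor 8) : (if (x = 0 ∨ x = z2) then (0 : ℂ) else fW x) = ((mI x : ℤ) : ℂ) := by
  unfold mI fW
  split_ifs <;> simp

/-- real/integer bridge for the bond term. [folklore] -/
theorem bR (x e : Tor 8) :
    (if (x = 0 ∨ x = z2 ∨ x + e = 0 ∨ x + e = z2) then (0 : ℝ) else ‖fW x - fW (x + e)‖ ^ 2) = ((bI x e : ℤ) : ℝ) := by
  unfold bI fW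
  split_ifs
  · simp
  · rw [show (((wI x : ℤ)) : ℂ) - ((wI (x + e) : ℤ) : ℂ) = (((wI x - wI (x + e) : ℤ)) : ℂ) by push_cast; ring,
      Complex.norm_intCast, sq_abs]
    push_cast
    ring

/-- `ε₁(8) = 1 − √2/2`. [folklore] -/
theorem eps1_eight : eps1 8 = 1 - Real.sqrt 2 / 2 := by
  unfold eps1
  rw [show (2 * Real.pi / ((8 : ℕ) : ℝ)) = Real.pi / 4 by push_cast; ring, Real.cos_pi_div_four]

/-- ★★ **HOLE₂(.75) is false at `L = 8`:** `¬ TwoHoleGap 8 (¾ε₁)` (pair `(0,0),(1,1)`, Rayleigh quotient `.7369ε₁`). [folklore] -/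
theorem not_twoHoleGap_eight : ¬ TwoHoleGap 8 (3 / 4 * eps1 8) := by
  intro h
  have hne : (0 : Tor 8) ≠ z2 := by decide
  have hmean : (∑ x : Tor 8, (if (x = 0 ∨ x = z2) then (0 : ℂ) else fW x)) = 0 := by
    rw [Finset.sum_congr rfl (fun x _ => mR x), ← Int.cast_sum, sum_mI]
    simp
  have key := h 0 z2 hne fW hmean
  have hR : ∀ x : Tor 8, ((nnList 8).map (fun e =>
      if (x = 0 ∨ x = z2 ∨ x + e = 0 ∨ x + e = z2) then (0 : ℝ) else ‖fW x - fW (x + e)‖ ^ 2)).sum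
        = ((bI x (ex 8) + bI x (-ex 8) + bI x (ey 8) + bI x (-ey 8) : ℤ) : ℝ) := by
    intro x
    rw [nnList_map_sum, bR, bR, bR, bR]
    push_cast
    ring
  rw [Finset.sum_congr rfl (fun x _ => aR x), Finset.sum_congr rfl (fun x _ => hR x), ← Int.cast_sum, ← Int.cast_sum,
    sum_aI, sum_bI, eps1_eight] at key
  have hs : Real.sqrt 2 < 1.4143 := by
    rw [Real.sqrt_lt' (by norm_num)]; norm_num
  push_cast at key
  nlinarith

end HoleTwoL8

end Summit.HubbardSuperconductivity.HubbardSuperconductivity.Theorems.AnisotropyChord.Transfer.Fibre3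

end
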